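import Literature.Probability.LatticeModels.HalfPlaneStates
import Literature.Probability.LatticeModels.FlipReflectionDomination
import Literature.Probability.LatticeModels.IsingFiniteEnergy
import Literature.Probability.LatticeModels.IsingThermodynamicsProofs
import Literature.Probability.LatticeModels.StarCrossing
import HarnessLib

/-!
# No positive magnetisation above a `-` wall (the strip argument)

Topic `Probability/LatticeModels`. For the semi-infinite limit state `μ^±_0` of the zero-field Ising
model on `ℤ²` above the wall `{x₂ < 0}` frozen to `-1` (`HalfPlaneStates.upperPMState`,
Georgii–Higuchi 2000, §4, eq. (2)), we prove

* **`integral_spinAt_vert_upperPMState_le_zero`** — `μ^±_0(σ_{(0,n)}) ≤ 0` for every `n ≥ 0` and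
  `β ≥ 0`.

This replaces, in our proof of Georgii–Higuchi's Lemma 4.2, the lower bound `a ≥ θ/2` obtained
there from the point-to-semicircuit Lemma 2.3: it yields `μ⁺_-(σ_0) ≤ 0` for the translation
invariant limit `μ⁺_-`, hence weight `≥ 1/2` on the minus phase (see `WallLimitState`,
`NoPercolationBorderedHalfPlane`). The argument is finite-volume and uses only the tools of GH §2:

1. `μ^±_0 ≼ μ^{η±}_{Γ}` for the strip box `Γ = [-K, K] × [0, 2n]` (FKG volume monotonicity with `+`
   spins on the removed sites, `isingExpect_fixed_anti_volume`), so `μ^±_0(σ_v) ≤ μ^{η±}_Γ(σ_v)`,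
   `v = (0, n)`.
2. *Symmetric inner boxes.* For `I_k = (-k, k) × [0, 2n]` with boundary condition `-1` on the columns
   `±k`, `+1` above and `-1` below, the flip-reflection `R∘T` in the middle row (`R(x) = (x₁, 2n-x₂)`)
   satisfies `η ≤ R∘T(η)`, whence by FKG in the boundary condition and the `R∘T`-covariance
   (`isingExpect_fixed_flipRelabel`, GH Lemma 2.2) `μ^η_{I_k}(σ_v) ≤ μ^η_{I_k}(σ_v ∘ R∘T) = -μ^η_{I_k}(σ_v)`,
   i.e. `μ^η_{I_k}(σ_v) ≤ 0` (`isingExpect_spinAt_innerBox_le_zero`).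
3. *Markov property.* On the event `E_k` that `±k` is the outermost pair of columns `≤ K` frozen to
   `-1`, the conditional distribution in `I_k` under `μ^{η±}_Γ` is `μ^{ζ}_{I_k}` with `ζ` as in 2 on
   `∂I_k` (DLR consistency of the finite-volume kernels, Friedli–Velenik Lemma 6.7), so
   `μ^{η±}_Γ(σ_v ; E_k) ≤ 0`.
4. *Finite energy.* The events `D_k = {σ ≡ -1 on the columns ±k}` have conditional probability
   `≥ δ > 0` given everything else, uniformly (`finiteEnergyConst_le_isingSpecification_of_glueWith_mem`),
   so `μ^{η±}_Γ(no D_k, k ≤ K) ≤ (1-δ)^K`.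
5. Hence `μ^±_0(σ_v) ≤ (1-δ)^K` for all `K`, and `K → ∞`.

## References

* H.-O. Georgii, Y. Higuchi, J. Math. Phys. 41 (2000), §2 (stochastic domination, flip-reflection
  domination Lemma 2.2, Markov property, finite energy), §4 eq. (2) and Lemma 4.2
  [GeorgiiHiguchi2000].
* S. Friedli, Y. Velenik, *Statistical Mechanics of Lattice Systems* (CUP 2017), Lemma 3.22,
  Exercise 3.13, Lemma 6.7 [FriedliVelenik2017].
-/

noncomputable section

open MeasureTheory Filter Topology Finset
open Literature.Probability.Percolation
open scoped ENNReal

namespace Literature.Probability.LatticeModels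

/-! ### Finite-volume tools -/

section Tools

variable {V : Type*} [DecidableEq V] (G : SimpleGraph V) [G.LocallyFinite]

/-- `μ^η_Λ`-almost every configuration agrees with `η` off `Λ`. [cite: FriedliVelenik2017, §3.1] -/
theorem ae_isingMeasure_fixed_eq_outside [Countable V] (Λ : Finset V) (β h : ℝ) (η : SpinConfig V) :
    ∀ᵐ σ ∂isingMeasure G Λ β h (.fixed η), ∀ x ∉ Λ, σ x = η x := by
  have h1 := isingMeasure_range_glue_holds G Λ β h (.fixed η)
  have hsub : Set.range (fun τ : Λ → ℤˣ => glue Λ τ (.fixed η)) ⊆ {σ : SpinConfig V | ∀ x ∉ Λ, σ x = η x} := by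
    rintro _ ⟨τ, rfl⟩ x hx
    simp [hx]
  rw [ae_iff]
  refine measure_mono_null (fun σ hσ hσ' => hσ (hsub hσ')) ?_
  exact (prob_compl_eq_zero_iff (Set.countable_range _).measurableSet).2 h1

/-- **Events determined outside the volume factor out of the kernel**: if membership in `F` depends
only on the spins off `Λ`, then `μ^σ_Λ(F ∩ S) = 1_F(σ) μ^σ_Λ(S)`. [cite: FriedliVelenik2017, Lemma 6.7] -/
theorem isingMeasure_fixed_inter_of_determined_outside [Countable V] (Λ : Finset V) (β h : ℝ) (σ : SpinConfig V)
    {F S : Set (SpinConfig V)}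
    (hF : ∀ ζ ζ' : SpinConfig V, (∀ x ∉ Λ, ζ x = ζ' x) → (ζ ∈ F ↔ ζ' ∈ F)) :
    isingMeasure G Λ β h (.fixed σ) (F ∩ S) = F.indicator (fun σ => isingMeasure G Λ β h (.fixed σ) S) σ := by
  have hae := ae_isingMeasure_fixed_eq_outside G Λ β h σ
  by_cases hσ : σ ∈ F
  · rw [Set.indicator_of_mem hσ]
    refine measure_congr ?_
    filter_upwards [hae] with ζ hζ
    have hζF : ζ ∈ F := (hF ζ σ hζ).2 hσ
    show (ζ ∈ F ∩ S) = (ζ ∈ S)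
    exact propext ⟨fun h' => h'.2, fun h' => ⟨hζF, h'⟩⟩
  · rw [Set.indicator_of_notMem hσ]
    refine measure_mono_null_ae ?_ (measure_empty (μ := isingMeasure G Λ β h (.fixed σ)))
    filter_upwards [hae] with ζ hζ
    show (ζ ∈ F ∩ S) ≤ (ζ ∈ (∅ : Set (SpinConfig V)))
    intro h'
    exact hσ ((hF ζ σ hζ).1 h'.1)

/-- **DLR with an outside event** for the finite-volume measure: for `Λ ⊆ Γ` and `F` determined off
`Λ`, `μ^η_Γ(F ∩ S) = ∫ 1_F(σ) μ^σ_Λ(S) μ^η_Γ(dσ)`. [cite: FriedliVelenik2017, Lemma 6.7] -/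
theorem isingMeasure_fixed_inter_eq_lintegral [Countable V] {Λ Γ : Finset V} (hsub : Λ ⊆ Γ) (β h : ℝ) (η : SpinConfig V)
    {F S : Set (SpinConfig V)}
    (hF : ∀ ζ ζ' : SpinConfig V, (∀ x ∉ Λ, ζ x = ζ' x) → (ζ ∈ F ↔ ζ' ∈ F))
    (hFS : MeasurableSet (F ∩ S)) :
    isingMeasure G Γ β h (.fixed η) (F ∩ S) =
      ∫⁻ σ, F.indicator (fun σ => isingMeasure G Λ β h (.fixed σ) S) σ ∂isingMeasure G Γ β h (.fixed η) := by
  rw [← lintegral_isingMeasure_fixed_consistent G hsub β h η hFS]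
  exact lintegral_congr fun σ => isingMeasure_fixed_inter_of_determined_outside G Λ β h σ hF

/-- **Finite energy for a measure satisfying the DLR equations in a region** (as
`IsGibbsMeasure.mul_measure_glueWith_preimage_le`, which is the case `W = univ`). [cite: GeorgiiHiguchi2000, Lemma 3.4 (proof, p. 9)] -/
theorem IsGibbsIn.mul_measure_glueWith_preimage_le {β h : ℝ} {W : Set V} {μ : Measure (SpinConfig V)}
    (hμ : IsGibbsIn W (isingSpecification G β h) μ) {Λ : Finset V} (hΛ : (↑Λ : Set V) ⊆ W)
    (τ : Λ → ℤˣ) {S : Set (SpinConfig V)} (hS : MeasurableSet S) :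
    ENNReal.ofReal (Real.exp (-(2 * |β| * (#(edgesTouching G Λ) + |h| * #Λ))) / 2 ^ #Λ) *
        μ {η | glueWith Λ τ η ∈ S} ≤ μ S := by
  set δ : ℝ≥0∞ :=
    ENNReal.ofReal (Real.exp (-(2 * |β| * (#(edgesTouching G Λ) + |h| * #Λ))) / 2 ^ #Λ) with hδ
  have hA : MeasurableSet {η : SpinConfig V | glueWith Λ τ η ∈ S} :=
    measurable_glueWith_right Λ τ hS
  rw [← hμ.2 Λ hΛ S hS]
  calc δ * μ {η | glueWith Λ τ η ∈ S}
      = ∫⁻ η, {η | glueWith Λ τ η ∈ S}.indicator (fun _ => δ) η ∂μ := by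
        rw [lintegral_indicator_const hA]
    _ ≤ ∫⁻ η, isingSpecification G β h Λ η S ∂μ := by
        refine lintegral_mono fun η => ?_
        by_cases hη : glueWith Λ τ η ∈ S
        · rw [Set.indicator_of_mem (show η ∈ {η | glueWith Λ τ η ∈ S} from hη)]
          exact finiteEnergyConst_le_isingSpecification_of_glueWith_mem G β h Λ η τ hη
        · rw [Set.indicator_of_notMem (show η ∉ {η | glueWith Λ τ η ∈ S} from hη)]
          exact bot_le

omit [DecidableEq V] in
/-- The magnetisation of a `±1` spin as a difference of probabilities. [folklore] -/
theorem integral_spinAt_eq_measureReal_sub (μ : Measure (SpinConfig V)) [IsFiniteMeasure μ] (v : V) :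
    ∫ σ, spinAt v σ ∂μ = μ.real {σ | σ v = 1} - μ.real {σ | σ v = -1} := by
  have hm1 : MeasurableSet {σ : SpinConfig V | σ v = 1} := measurableSet_eq_fun (measurable_pi_apply v) measurable_const
  have hm2 : MeasurableSet {σ : SpinConfig V | σ v = -1} := measurableSet_eq_fun (measurable_pi_apply v) measurable_const
  have heq : (fun σ : SpinConfig V => spinAt v σ) = fun σ =>
      {σ : SpinConfig V | σ v = 1}.indicator 1 σ - {σ : SpinConfig V | σ v = -1}.indicator 1 σ := by
    funext σ
    rcases Int.units_eq_one_or (σ v) with h1 | h1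
    · have : σ ∉ {σ : SpinConfig V | σ v = -1} := by simp [h1]
      rw [Set.indicator_of_mem (show σ ∈ {σ : SpinConfig V | σ v = 1} from h1), Set.indicator_of_notMem this]
      simp [spinAt, h1]
    · have : σ ∉ {σ : SpinConfig V | σ v = 1} := by simp [h1]
      rw [Set.indicator_of_notMem this, Set.indicator_of_mem (show σ ∈ {σ : SpinConfig V | σ v = -1} from h1)]
      simp [spinAt, h1]
  rw [heq, integral_sub ((integrable_const 1).indicator hm1) ((integrable_const 1).indicator hm2),
    integral_indicator_one hm1, integral_indicator_one hm2]

end Tools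

/-! ### Geometry of the strip -/

section Geometry

/-- The strip box `Γ_{K} = [-K, K] × [0, 2n]`. [cite: GeorgiiHiguchi2000, §4] -/
def stripBox (n K : ℕ) : Finset (Site 2) :=
  (box 2 (K + 2 * n)).filter fun x => |x 0| ≤ K ∧ 0 ≤ x 1 ∧ x 1 ≤ 2 * n

/-- The inner box `I_k = (-k, k) × [0, 2n]`. [cite: GeorgiiHiguchi2000, §4] -/
def innerBox (n k : ℕ) : Finset (Site 2) :=
  (box 2 (k + 2 * n)).filter fun x => |x 0| < k ∧ 0 ≤ x 1 ∧ x 1 ≤ 2 * n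

/-- The pair of columns `{±k} × [0, 2n]`. [cite: GeorgiiHiguchi2000, §4] -/
def colPair (n k : ℕ) : Finset (Site 2) :=
  (box 2 (k + 2 * n)).filter fun x => |x 0| = k ∧ 0 ≤ x 1 ∧ x 1 ≤ 2 * n

/-- Coordinate bounds give membership in the ambient box. [folklore] -/
private theorem mem_box_of_bounds {n k : ℕ} {x : Site 2} (h0 : |x 0| ≤ k) (h1 : 0 ≤ x 1) (h2 : x 1 ≤ 2 * n) :
    x ∈ box 2 (k + 2 * n) := by
  rw [mem_box]
  intro i
  rw [abs_le] at h0
  fin_cases i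
  · change -((k + 2 * n : ℕ) : ℤ) ≤ x 0 ∧ x 0 ≤ ((k + 2 * n : ℕ) : ℤ)
    push_cast; constructor <;> linarith
  · change -((k + 2 * n : ℕ) : ℤ) ≤ x 1 ∧ x 1 ≤ ((k + 2 * n : ℕ) : ℤ)
    push_cast; constructor <;> linarith

/-- Membership in the strip box. [folklore] -/
theorem mem_stripBox {n K : ℕ} {x : Site 2} :
    x ∈ stripBox n K ↔ |x 0| ≤ K ∧ 0 ≤ x 1 ∧ x 1 ≤ 2 * n := by
  rw [stripBox, Finset.mem_filter]
  exact ⟨fun h => h.2, fun h => ⟨mem_box_of_bounds h.1 h.2.1 h.2.2, h⟩⟩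

/-- Membership in the inner box. [folklore] -/
theorem mem_innerBox {n k : ℕ} {x : Site 2} :
    x ∈ innerBox n k ↔ |x 0| < k ∧ 0 ≤ x 1 ∧ x 1 ≤ 2 * n := by
  rw [innerBox, Finset.mem_filter]
  exact ⟨fun h => h.2, fun h => ⟨mem_box_of_bounds h.1.le h.2.1 h.2.2, h⟩⟩

/-- Membership in the pair of columns. [folklore] -/
theorem mem_colPair {n k : ℕ} {x : Site 2} :
    x ∈ colPair n k ↔ |x 0| = k ∧ 0 ≤ x 1 ∧ x 1 ≤ 2 * n := by
  rw [colPair, Finset.mem_filter]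
  exact ⟨fun h => h.2, fun h => ⟨mem_box_of_bounds h.1.le h.2.1 h.2.2, h⟩⟩

/-- `I_k ⊆ Γ_K` for `k ≤ K`. [folklore] -/
theorem innerBox_subset_stripBox {n k K : ℕ} (hk : k ≤ K) : innerBox n k ⊆ stripBox n K := fun x hx => by
  rw [mem_innerBox] at hx; rw [mem_stripBox]
  exact ⟨by have : (k : ℤ) ≤ K := by exact_mod_cast hk
            linarith [hx.1], hx.2⟩

/-- The columns `±k` lie in `Γ_K` for `k ≤ K`. [folklore] -/
theorem colPair_subset_stripBox {n k K : ℕ} (hk : k ≤ K) : colPair n k ⊆ stripBox n K := fun x hx => by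
  rw [mem_colPair] at hx; rw [mem_stripBox]
  exact ⟨by have : (k : ℤ) ≤ K := by exact_mod_cast hk
            linarith [hx.1], hx.2⟩

/-- `Γ_K ⊆ Δ_{K+2n}(0)`. [folklore] -/
theorem stripBox_subset_halfBox (n K : ℕ) : stripBox n K ⊆ halfBox 0 (K + 2 * n) := fun x hx => by
  rw [mem_stripBox] at hx; rw [mem_halfBox]
  push_cast
  exact ⟨by linarith [hx.1], hx.2.1, by linarith [hx.2.2]⟩

/-- The pair of columns has at most `2(2n+1)` sites. [folklore] -/
theorem card_colPair_le (n k : ℕ) : #(colPair n k) ≤ 2 * (2 * n + 1) := by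
  classical
  -- inject into `{±1} × [0, 2n]`
  have hsub : colPair n k ⊆ (({(k : ℤ), -(k : ℤ)} : Finset ℤ) ×ˢ Finset.Icc (0 : ℤ) (2 * n)).image
      fun p => (![p.1, p.2] : Site 2) := by
    intro x hx
    rw [mem_colPair] at hx
    rw [Finset.mem_image]
    refine ⟨(x 0, x 1), ?_, ?_⟩
    · rw [Finset.mem_product, Finset.mem_insert, Finset.mem_singleton, Finset.mem_Icc]
      refine ⟨?_, hx.2.1, hx.2.2⟩
      rcases abs_eq (Nat.cast_nonneg k) |>.1 hx.1 with h | h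
      · exact Or.inl h
      · exact Or.inr h
    · ext i; fin_cases i <;> rfl
  refine (Finset.card_le_card hsub).trans (Finset.card_image_le.trans ?_)
  rw [Finset.card_product, Int.card_Icc]
  have h1 : #({(k : ℤ), -(k : ℤ)} : Finset ℤ) ≤ 2 := Finset.card_le_two
  have h2 : (2 * (n : ℤ) + 1 - 0).toNat = 2 * n + 1 := by
    have : (2 * (n : ℤ) + 1 - 0) = ((2 * n + 1 : ℕ) : ℤ) := by push_cast; ring
    rw [this, Int.toNat_natCast]
  rw [h2]
  exact Nat.mul_le_mul_right _ h1

/-- The reflection `(x₁, x₂) ↦ (x₁, c - x₂)` in the horizontal line `x₂ = c/2`. [folklore] -/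
def rowReflect (c : ℤ) : zdGraph 2 ≃g zdGraph 2 := (reflectCoord 1).trans (zdShiftIso (vert c))

/-- First coordinate of the row reflection. [folklore] -/
@[simp] theorem rowReflect_apply_zero (c : ℤ) (x : Site 2) : rowReflect c x 0 = x 0 := by
  simp [rowReflect, RelIso.trans_apply, reflectCoord_apply]

/-- Second coordinate of the row reflection. [folklore] -/
@[simp] theorem rowReflect_apply_one (c : ℤ) (x : Site 2) : rowReflect c x 1 = c - x 1 := by
  simp [rowReflect, RelIso.trans_apply, reflectCoord_apply]; ring

/-- The row reflection is an involution. [folklore] -/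
theorem rowReflect_rowReflect (c : ℤ) (x : Site 2) : rowReflect c (rowReflect c x) = x := by
  ext i; fin_cases i
  · change rowReflect c (rowReflect c x) 0 = x 0; simp
  · change rowReflect c (rowReflect c x) 1 = x 1; simp

/-- The inverse of the row reflection is itself. [folklore] -/
theorem rowReflect_symm_apply (c : ℤ) (x : Site 2) : (rowReflect c).toEquiv.symm x = rowReflect c x := by
  rw [Equiv.symm_apply_eq]
  exact (rowReflect_rowReflect c x).symm

/-- The inner box is invariant under the reflection in its middle row. [folklore] -/
theorem innerBox_map_rowReflect (n k : ℕ) :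
    (innerBox n k).map (rowReflect (2 * n)).toEquiv.toEmbedding = innerBox n k := by
  ext y
  rw [mem_map_toEmbedding_iff, rowReflect_symm_apply, mem_innerBox, mem_innerBox, rowReflect_apply_zero,
    rowReflect_apply_one]
  constructor
  · rintro ⟨h0, h1, h2⟩; exact ⟨h0, by linarith, by linarith⟩
  · rintro ⟨h0, h1, h2⟩; exact ⟨h0, by linarith, by linarith⟩

/-- The centre `v = (0, n)` is fixed by the reflection. [folklore] -/
theorem rowReflect_vert (n : ℕ) : rowReflect (2 * n) (vert n) = vert n := by
  ext i; fin_cases i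
  · change rowReflect (2 * n) (vert n) 0 = vert n 0; simp
  · change rowReflect (2 * n) (vert n) 1 = vert n 1; simp; ring

end Geometry

/-! ### Step 2: symmetric inner boxes have nonpositive centre magnetisation -/

section Inner

/-- The boundary condition of the inner boxes: `+1` above the strip, `-1` elsewhere (below the strip
and on the side columns). [cite: GeorgiiHiguchi2000, §4] -/
def stripMinusBC (n : ℕ) : SpinConfig (Site 2) := fun x => if (2 * n : ℤ) < x 1 then 1 else -1

/-- `η ≤ R∘T(η)` for the inner boundary condition and the middle-row flip-reflection. [cite: GeorgiiHiguchi2000, Lemma 2.2] -/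
theorem stripMinusBC_le_flipRelabel (n : ℕ) :
    stripMinusBC n ≤ flipRelabel (rowReflect (2 * n)).toEquiv (stripMinusBC n) := by
  intro x
  rw [flipRelabel, Pi.neg_apply, configRelabel_apply, rowReflect_symm_apply]
  simp only [stripMinusBC, rowReflect_apply_one]
  by_cases h1 : (2 * n : ℤ) < x 1
  · have h2 : ¬ (2 * (n : ℤ) < 2 * n - x 1) := by linarith
    rw [if_pos h1, if_neg h2]; simp
  · rw [if_neg h1]; exact neg_one_le_intUnits _

variable {β : ℝ}

/-- **Nonpositive centre magnetisation in the symmetric inner box** (flip-reflection domination,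
GH Lemma 2.2, in finite volume): `μ^{η}_{I_k;β,0}(σ_{(0,n)}) ≤ 0`. [cite: GeorgiiHiguchi2000, Lemma 2.2] -/
theorem isingExpect_spinAt_innerBox_le_zero (hβ : 0 ≤ β) (n k : ℕ) :
    isingExpect (zdGraph 2) (innerBox n k) β 0 (.fixed (stripMinusBC n)) (spinAt (vert n)) ≤ 0 := by
  set R := rowReflect (2 * (n : ℤ)) with hR
  set m := isingExpect (zdGraph 2) (innerBox n k) β 0 (.fixed (stripMinusBC n)) (spinAt (vert n)) with hm
  have h1 : m ≤ isingExpect (zdGraph 2) (innerBox n k) β 0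
      (.fixed (flipRelabel R.toEquiv (stripMinusBC n))) (spinAt (vert n)) :=
    isingExpect_fixed_mono (zdGraph 2) hβ _ 0 (stripMinusBC_le_flipRelabel n) (spinAt_mono _) (measurable_spinAt _)
  have h2 := isingExpect_fixed_flipRelabel R (innerBox_map_rowReflect n k) β (stripMinusBC n)
    (measurable_spinAt (vert n))
  have h3 : (spinAt (vert n) ∘ flipRelabel R.toEquiv : SpinConfig (Site 2) → ℝ) = fun σ => (-1) * spinAt (vert n) σ := by
    funext σ
    simp only [Function.comp_apply, spinAt, flipRelabel, Pi.neg_apply, configRelabel_apply, hR,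
      rowReflect_symm_apply, rowReflect_vert, Units.val_neg, Int.cast_neg]
    ring
  rw [h2, h3, isingExpect_const_mul' _ _ _ _ β (-1) (measurable_spinAt _)] at h1
  change m ≤ -1 * m at h1
  linarith

end Inner

/-! ### Steps 3–5: the strip argument -/

section Strip

variable {β : ℝ}

/-- The event `D_k`: both columns `±k` (rows `0..2n`) are frozen to `-1`. [cite: GeorgiiHiguchi2000, §4] -/
def minusCols (n k : ℕ) : Set (SpinConfig (Site 2)) := {σ | ∀ x ∈ colPair n k, σ x = -1}

/-- `D_k` is measurable. [folklore] -/
theorem measurableSet_minusCols (n k : ℕ) : MeasurableSet (minusCols n k) := by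
  have : minusCols n k = ⋂ x ∈ colPair n k, {σ : SpinConfig (Site 2) | σ x = -1} := by
    ext σ; simp [minusCols]
  rw [this]
  exact Finset.measurableSet_biInter _ fun x _ => measurableSet_eq_fun (measurable_pi_apply x) measurable_const

/-- The event `E_k`: `±k` is the outermost pair of `-`columns among `1 ≤ j ≤ K`. [cite: GeorgiiHiguchi2000, §4] -/
def outermostMinusCols (n K k : ℕ) : Set (SpinConfig (Site 2)) :=
  minusCols n k ∩ ⋂ j ∈ Finset.Ioc k K, (minusCols n j)ᶜ

/-- `E_k` is measurable. [folklore] -/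
theorem measurableSet_outermostMinusCols (n K k : ℕ) : MeasurableSet (outermostMinusCols n K k) :=
  (measurableSet_minusCols n k).inter
    (Finset.measurableSet_biInter _ fun j _ => (measurableSet_minusCols n j).compl)

/-- The finite-volume measure on the strip box with the `±` boundary condition. [cite: GeorgiiHiguchi2000, §4] -/
def stripMeasure (β : ℝ) (n K : ℕ) : Measure (SpinConfig (Site 2)) :=
  isingMeasure (zdGraph 2) (stripBox n K) β 0 (.fixed (pmBC 0))

/-- The strip measure is a probability measure. [folklore] -/
instance (β : ℝ) (n K : ℕ) : IsProbabilityMeasure (stripMeasure β n K) := by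
  unfold stripMeasure; infer_instance

/-- Step 1: `μ^±_0(σ_v) ≤ μ^{η±}_Γ(σ_v)`. [cite: GeorgiiHiguchi2000, §4 eq. (2)] -/
theorem integral_spinAt_upperPMState_le_strip (hβ : 0 ≤ β) (n K : ℕ) :
    ∫ σ, spinAt (vert n) σ ∂(upperPMState hβ 0) ≤ ∫ σ, spinAt (vert n) σ ∂(stripMeasure β n K) := by
  have hdep : DependsOn (spinAt (V := Site 2) (vert n)) (↑({vert n} : Finset (Site 2)) : Set (Site 2)) := by
    intro σ τ h; simp only [spinAt, h (vert n) (by simp)]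
  calc ∫ σ, spinAt (vert n) σ ∂(upperPMState hβ 0)
      ≤ ∫ σ, spinAt (vert n) σ ∂(halfBoxMeasure β 0 (K + 2 * n)) :=
        integral_upperPMState_le hβ 0 hdep (spinAt_mono _) (measurable_spinAt _)
          (fun σ => (abs_spinAt _ σ).le) _
    _ ≤ ∫ σ, spinAt (vert n) σ ∂(stripMeasure β n K) :=
        isingExpect_fixed_anti_volume (zdGraph 2) hβ (stripBox_subset_halfBox n K) 0
          (fun x hx => pmBC_of_le (mem_halfBox.1 (Finset.mem_sdiff.1 hx).1).2.1)
          (spinAt_mono _) (measurable_spinAt _)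

/-- The uniform finite-energy constant for a pair of columns. [folklore] -/
def colDelta (β : ℝ) (n : ℕ) : ℝ :=
  Real.exp (-(2 * |β| * (4 * (2 * (2 * n + 1))))) / 2 ^ (2 * (2 * n + 1))

/-- `δ > 0`. [folklore] -/
theorem colDelta_pos (β : ℝ) (n : ℕ) : 0 < colDelta β n := by unfold colDelta; positivity

/-- `δ ≤ 1`. [folklore] -/
theorem colDelta_le_one (β : ℝ) (n : ℕ) : colDelta β n ≤ 1 := by
  unfold colDelta
  refine div_le_one_of_le₀ ?_ (by positivity)
  refine (Real.exp_le_one_iff.2 ?_).trans (one_le_pow₀ (by norm_num))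
  have : 0 ≤ 2 * |β| * (4 * (2 * (2 * (n : ℝ) + 1))) := by positivity
  linarith

/-- The finite-energy constant of the pair of columns `±k` is at least `colDelta`. [folklore] -/
theorem colDelta_le_finiteEnergyConst (β : ℝ) (n k : ℕ) :
    colDelta β n ≤ Real.exp (-(2 * |β| * (#(edgesTouching (zdGraph 2) (colPair n k)) + |(0 : ℝ)| * #(colPair n k)))) /
      2 ^ #(colPair n k) := by
  have hcard := card_colPair_le n k
  have hE : #(edgesTouching (zdGraph 2) (colPair n k)) ≤ 4 * (2 * (2 * n + 1)) :=
    (card_edgesTouching_le_of_degree_le (zdGraph 2) (Δ := 4) (fun x => by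
      have := card_incidenceFinset_zdGraph_le (d := 2) x; omega) _).trans (Nat.mul_le_mul_left 4 hcard)
  unfold colDelta
  rw [abs_zero, zero_mul, add_zero]
  refine div_le_div₀ (Real.exp_pos _).le (Real.exp_le_exp.2 ?_) (by positivity)
    (pow_le_pow_right₀ (by norm_num) hcard)
  have h1 : (#(edgesTouching (zdGraph 2) (colPair n k)) : ℝ) ≤ 4 * (2 * (2 * n + 1)) := by exact_mod_cast hE
  nlinarith [abs_nonneg β]

/-- **Finite energy, conditional form**: for an event `F` determined off the columns `±k ⊆ Γ`,
`δ · μ^{η±}_Γ(F) ≤ μ^{η±}_Γ(F ∩ D_k)`. [cite: GeorgiiHiguchi2000, Lemma 3.4 (proof, p. 9)] -/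
theorem colDelta_mul_le_stripMeasure_inter_minusCols (β : ℝ) {n k K : ℕ} (hk : k ≤ K)
    {F : Set (SpinConfig (Site 2))} (hFm : MeasurableSet F)
    (hF : ∀ ζ ζ' : SpinConfig (Site 2), (∀ x ∉ colPair n k, ζ x = ζ' x) → (ζ ∈ F ↔ ζ' ∈ F)) :
    ENNReal.ofReal (colDelta β n) * stripMeasure β n K F ≤ stripMeasure β n K (F ∩ minusCols n k) := by
  have hG := isGibbsIn_isingMeasure_fixed (zdGraph 2) (stripBox n K) β 0 (pmBC 0)
  have h1 := IsGibbsIn.mul_measure_glueWith_preimage_le (zdGraph 2) hG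
    (Finset.coe_subset.2 (colPair_subset_stripBox (n := n) hk)) (fun _ => (-1 : ℤˣ))
    (hFm.inter (measurableSet_minusCols n k))
  have hsub : F ⊆ {η : SpinConfig (Site 2) | glueWith (colPair n k) (fun _ => (-1 : ℤˣ)) η ∈ F ∩ minusCols n k} := by
    intro η hη
    refine ⟨(hF _ η fun x hx => glueWith_apply_not_mem _ _ _ hx).2 hη, fun x hx => ?_⟩
    exact glueWith_apply_mem _ _ _ hx
  calc ENNReal.ofReal (colDelta β n) * stripMeasure β n K F
      ≤ ENNReal.ofReal (Real.exp (-(2 * |β| * (#(edgesTouching (zdGraph 2) (colPair n k)) +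
          |(0 : ℝ)| * #(colPair n k)))) / 2 ^ #(colPair n k)) *
          stripMeasure β n K {η | glueWith (colPair n k) (fun _ => (-1 : ℤˣ)) η ∈ F ∩ minusCols n k} :=
        mul_le_mul' (ENNReal.ofReal_le_ofReal (colDelta_le_finiteEnergyConst β n k)) (measure_mono hsub)
    _ ≤ stripMeasure β n K (F ∩ minusCols n k) := h1

/-- **Step 4: no pair of `-`columns among `1..K` has probability `≤ (1 - δ)^K`.** [cite: GeorgiiHiguchi2000, Lemma 3.4 (proof, p. 9)] -/
theorem stripMeasure_noMinusCols_le (β : ℝ) (n K : ℕ) :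
    ∀ j, j ≤ K → (stripMeasure β n K).real (⋂ k ∈ Finset.Icc 1 j, (minusCols n k)ᶜ) ≤ (1 - colDelta β n) ^ j := by
  intro j
  induction j with
  | zero => intro _; simp
  | succ j ih =>
    intro hj
    set F : Set (SpinConfig (Site 2)) := ⋂ k ∈ Finset.Icc 1 j, (minusCols n k)ᶜ with hFdef
    have hFm : MeasurableSet F := Finset.measurableSet_biInter _ fun k _ => (measurableSet_minusCols n k).compl
    have hset : (⋂ k ∈ Finset.Icc 1 (j + 1), (minusCols n k)ᶜ) = F \ minusCols n (j + 1) := by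
      ext σ
      simp only [hFdef, Set.mem_iInter, Set.mem_compl_iff, Finset.mem_Icc, Set.mem_sdiff]
      constructor
      · intro h
        exact ⟨fun k hk => h k ⟨hk.1, hk.2.trans (Nat.le_succ j)⟩, h (j + 1) ⟨by omega, le_rfl⟩⟩
      · rintro ⟨h1, h2⟩ k hk
        rcases Nat.lt_or_ge k (j + 1) with hlt | hge
        · exact h1 k ⟨hk.1, by omega⟩
        · have : k = j + 1 := le_antisymm hk.2 hge
          subst this; exact h2
    rw [hset]
    -- `F` is determined off the columns `±(j+1)`
    have hF : ∀ ζ ζ' : SpinConfig (Site 2), (∀ x ∉ colPair n (j + 1), ζ x = ζ' x) → (ζ ∈ F ↔ ζ' ∈ F) := by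
      intro ζ ζ' hζ
      have key : ∀ k ∈ Finset.Icc 1 j, (ζ ∈ minusCols n k ↔ ζ' ∈ minusCols n k) := by
        intro k hk
        rw [Finset.mem_Icc] at hk
        have hx : ∀ x ∈ colPair n k, x ∉ colPair n (j + 1) := by
          intro x hx hx'
          rw [mem_colPair] at hx hx'
          have : (k : ℤ) = (j + 1 : ℕ) := hx.1.symm.trans hx'.1
          omega
        simp only [minusCols, Set.mem_setOf_eq]
        exact ⟨fun h x hx' => by rw [← hζ x (hx x hx')]; exact h x hx',
          fun h x hx' => by rw [hζ x (hx x hx')]; exact h x hx'⟩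
      simp only [hFdef, Set.mem_iInter, Set.mem_compl_iff]
      exact ⟨fun h k hk => (key k hk).not.1 (h k hk), fun h k hk => (key k hk).not.2 (h k hk)⟩
    have hfe := colDelta_mul_le_stripMeasure_inter_minusCols β (n := n) (by omega : j + 1 ≤ K) hFm hF
    have hfe' : colDelta β n * (stripMeasure β n K).real F ≤ (stripMeasure β n K).real (F ∩ minusCols n (j + 1)) := by
      have := ENNReal.toReal_mono (measure_ne_top _ _) hfe
      rwa [ENNReal.toReal_mul, ENNReal.toReal_ofReal (colDelta_pos β n).le] at this
    have hsplit : (stripMeasure β n K).real (F ∩ minusCols n (j + 1)) +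
        (stripMeasure β n K).real (F \ minusCols n (j + 1)) = (stripMeasure β n K).real F :=
      measureReal_inter_add_sdiff₀ (measurableSet_minusCols n (j + 1)).nullMeasurableSet
    have ih' := ih (by omega)
    calc (stripMeasure β n K).real (F \ minusCols n (j + 1))
        = (stripMeasure β n K).real F - (stripMeasure β n K).real (F ∩ minusCols n (j + 1)) := by linarith
      _ ≤ (1 - colDelta β n) * (stripMeasure β n K).real F := by nlinarith
      _ ≤ (1 - colDelta β n) * (1 - colDelta β n) ^ j :=
          mul_le_mul_of_nonneg_left ih' (by linarith [colDelta_le_one β n])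
      _ = (1 - colDelta β n) ^ (j + 1) := by ring

/-- **Step 3: on the outermost-columns event `E_k`, the centre spin is more likely `-` than `+`**
(Markov property in `I_k` and Step 2). [cite: GeorgiiHiguchi2000, §2 (Markov property) and Lemma 2.2] -/
theorem stripMeasure_outermost_inter_plus_le (hβ : 0 ≤ β) {n K k : ℕ} (hk1 : 1 ≤ k) (hkK : k ≤ K) :
    stripMeasure β n K (outermostMinusCols n K k ∩ {σ | σ (vert n) = 1}) ≤
      stripMeasure β n K (outermostMinusCols n K k ∩ {σ | σ (vert n) = -1}) := by
  have hI : innerBox n k ⊆ stripBox n K := innerBox_subset_stripBox hkK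
  have hm1 : MeasurableSet {σ : SpinConfig (Site 2) | σ (vert n) = 1} :=
    measurableSet_eq_fun (measurable_pi_apply _) measurable_const
  have hm2 : MeasurableSet {σ : SpinConfig (Site 2) | σ (vert n) = -1} :=
    measurableSet_eq_fun (measurable_pi_apply _) measurable_const
  have hE := measurableSet_outermostMinusCols n K k
  -- `E_k` is determined off `I_k`
  have hdet : ∀ ζ ζ' : SpinConfig (Site 2), (∀ x ∉ innerBox n k, ζ x = ζ' x) →
      (ζ ∈ outermostMinusCols n K k ↔ ζ' ∈ outermostMinusCols n K k) := by
    intro ζ ζ' hζ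
    have key : ∀ j, k ≤ j → (ζ ∈ minusCols n j ↔ ζ' ∈ minusCols n j) := by
      intro j hj
      have hx : ∀ x ∈ colPair n j, x ∉ innerBox n k := by
        intro x hx hx'
        rw [mem_colPair] at hx; rw [mem_innerBox] at hx'
        have : (k : ℤ) ≤ j := by exact_mod_cast hj
        linarith [hx.1, hx'.1]
      simp only [minusCols, Set.mem_setOf_eq]
      exact ⟨fun h x hx' => by rw [← hζ x (hx x hx')]; exact h x hx',
        fun h x hx' => by rw [hζ x (hx x hx')]; exact h x hx'⟩
    simp only [outermostMinusCols, Set.mem_inter_iff, Set.mem_iInter, Set.mem_compl_iff, Finset.mem_Ioc]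
    refine and_congr (key k le_rfl) (forall_congr' fun j => forall_congr' fun hj => ?_)
    rw [key j hj.1.le]
  change isingMeasure (zdGraph 2) (stripBox n K) β 0 (.fixed (pmBC 0))
      (outermostMinusCols n K k ∩ {σ | σ (vert n) = 1}) ≤
    isingMeasure (zdGraph 2) (stripBox n K) β 0 (.fixed (pmBC 0))
      (outermostMinusCols n K k ∩ {σ | σ (vert n) = -1})
  rw [isingMeasure_fixed_inter_eq_lintegral (zdGraph 2) hI β 0 (pmBC 0) hdet (hE.inter hm1),
    isingMeasure_fixed_inter_eq_lintegral (zdGraph 2) hI β 0 (pmBC 0) hdet (hE.inter hm2)]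
  refine lintegral_mono_ae ?_
  filter_upwards [ae_isingMeasure_fixed_eq_outside (zdGraph 2) (stripBox n K) β 0 (pmBC 0)] with σ hσ
  by_cases hσE : σ ∈ outermostMinusCols n K k
  · rw [Set.indicator_of_mem hσE, Set.indicator_of_mem hσE]
    -- the kernel `μ^σ_{I_k}` has the symmetric boundary condition on `∂I_k`
    have hbc : ∀ y ∈ outerBoundary (zdGraph 2) (innerBox n k), σ y = stripMinusBC n y := by
      intro y hy
      rw [mem_outerBoundary_iff] at hy
      obtain ⟨hyI, x, hx, hadj⟩ := hy
      rw [mem_innerBox] at hx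
      have hr : ∀ i, |y i - x i| ≤ 1 := (zdGraph_le_zdStarGraph hadj).2
      have hr0 := hr 0; have hr1 := hr 1
      rw [abs_le] at hr0 hr1
      by_cases hy1 : (2 * n : ℤ) < y 1
      · -- above the strip: outside `Γ`, frozen `+`
        have hyΓ : y ∉ stripBox n K := fun h => by rw [mem_stripBox] at h; linarith [h.2.2]
        rw [hσ y hyΓ, pmBC_of_le (by linarith), stripMinusBC, if_pos hy1]
      · by_cases hy0 : y 1 < 0
        · have hyΓ : y ∉ stripBox n K := fun h => by rw [mem_stripBox] at h; linarith [h.2.1]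
          rw [hσ y hyΓ, pmBC_of_lt hy0, stripMinusBC, if_neg hy1]
        · -- in the rows of the strip but not in `I_k`: on the columns `±k`
          push Not at hy1 hy0
          have hyk : |y 0| = k := by
            have h1 : ¬ (|y 0| < k) := fun h => hyI (mem_innerBox.2 ⟨h, hy0, hy1⟩)
            have h2 : |y 0| ≤ k := by
              rw [abs_le]; have := hx.1; rw [abs_lt] at this; constructor <;> linarith
            exact le_antisymm h2 (not_lt.1 h1)
          rw [hσE.1 y (mem_colPair.2 ⟨hyk, hy0, hy1⟩), stripMinusBC, if_neg (not_lt.2 hy1)]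
    -- compare the two probabilities through the centre magnetisation
    set κ := isingMeasure (zdGraph 2) (innerBox n k) β 0 (.fixed σ) with hκ
    have hmag : ∫ τ, spinAt (vert n) τ ∂κ ≤ 0 := by
      have hdepI : ∀ τ τ' : SpinConfig (Site 2), (∀ x ∈ innerBox n k, τ x = τ' x) →
          spinAt (vert n) τ = spinAt (vert n) τ' := by
        intro τ τ' h
        have hv : vert (n : ℤ) ∈ innerBox n k := by
          rw [mem_innerBox]; simp only [vert_apply_zero, vert_apply_one, abs_zero]
          exact ⟨by exact_mod_cast hk1, by positivity, by linarith⟩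
        simp only [spinAt, h _ hv]
      have := isingExpect_fixed_congr_outerBoundary (zdGraph 2) hbc β 0 (measurable_spinAt (vert n)) hdepI
      rw [isingExpect] at this
      rw [hκ, this]
      exact isingExpect_spinAt_innerBox_le_zero hβ n k
    rw [integral_spinAt_eq_measureReal_sub] at hmag
    have hle : κ.real {σ | σ (vert n) = 1} ≤ κ.real {σ | σ (vert n) = -1} := by linarith
    exact (ENNReal.toReal_le_toReal (measure_ne_top _ _) (measure_ne_top _ _)).1 hle
  · rw [Set.indicator_of_notMem hσE, Set.indicator_of_notMem hσE]

/-- **No positive magnetisation above the wall**: `μ^±_0(σ_{(0,n)}) ≤ 0` for all `n ≥ 0`, `β ≥ 0`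
(module docstring, Steps 1–5). [cite: GeorgiiHiguchi2000, Lemma 4.2] -/
theorem integral_spinAt_vert_upperPMState_le_zero (hβ : 0 ≤ β) (n : ℕ) :
    ∫ σ, spinAt (vert n) σ ∂(upperPMState hβ 0) ≤ 0 := by
  -- it suffices to bound by `(1-δ)^K` for every `K`
  have hbound : ∀ K : ℕ, ∫ σ, spinAt (vert n) σ ∂(upperPMState hβ 0) ≤ (1 - colDelta β n) ^ K := by
    intro K
    refine (integral_spinAt_upperPMState_le_strip hβ n K).trans ?_
    set ρ := stripMeasure β n K with hρ
    have hm : ∀ s : ℤˣ, MeasurableSet {σ : SpinConfig (Site 2) | σ (vert n) = s} := fun s =>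
      measurableSet_eq_fun (measurable_pi_apply _) measurable_const
    set A : Set (SpinConfig (Site 2)) := ⋃ k ∈ Finset.Icc 1 K, minusCols n k with hA
    have hAm : MeasurableSet A := Finset.measurableSet_biUnion _ fun k _ => measurableSet_minusCols n k
    -- partition of `A` into the outermost events
    have hdisj : Set.PairwiseDisjoint (↑(Finset.Icc 1 K) : Set ℕ) (outermostMinusCols n K) := by
      intro k hk k' hk' hkk'
      rw [Function.onFun, Set.disjoint_left]
      intro σ h1 h2
      rcases Nat.lt_or_gt_of_ne hkk' with hlt | hlt
      · exact Set.mem_iInter₂.1 h1.2 k' (Finset.mem_Ioc.2 ⟨hlt, (Finset.mem_Icc.1 hk').2⟩) h2.1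
      · exact Set.mem_iInter₂.1 h2.2 k (Finset.mem_Ioc.2 ⟨hlt, (Finset.mem_Icc.1 hk).2⟩) h1.1
    have hcover : A = ⋃ k ∈ Finset.Icc 1 K, outermostMinusCols n K k := by
      apply le_antisymm
      · intro σ hσ
        classical
        obtain ⟨k, hk, hσk⟩ := Set.mem_iUnion₂.1 hσ
        -- the largest `j ∈ [1, K]` with `σ ∈ D_j`
        set T := (Finset.Icc 1 K).filter fun j => σ ∈ minusCols n j with hT
        have hkT : k ∈ T := Finset.mem_filter.2 ⟨hk, hσk⟩
        have hTne : T.Nonempty := ⟨k, hkT⟩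
        set j := T.max' hTne with hj
        have hjT : j ∈ T := Finset.max'_mem T hTne
        refine Set.mem_iUnion₂.2 ⟨j, (Finset.mem_filter.1 hjT).1, (Finset.mem_filter.1 hjT).2, ?_⟩
        refine Set.mem_iInter₂.2 fun i hi hσi => ?_
        have hiT : i ∈ T := Finset.mem_filter.2
          ⟨Finset.mem_Icc.2 ⟨by linarith [(Finset.mem_Icc.1 (Finset.mem_filter.1 hjT).1).1, (Finset.mem_Ioc.1 hi).1],
            (Finset.mem_Ioc.1 hi).2⟩, hσi⟩
        have := Finset.le_max' T i hiT
        rw [← hj] at this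
        exact absurd (Finset.mem_Ioc.1 hi).1 (not_lt.2 this)
      · exact Set.iUnion₂_subset fun k hk => Set.Subset.trans Set.inter_subset_left
          (Set.subset_iUnion₂ (s := fun k _ => minusCols n k) k hk)
    -- decomposition of `ρ{σ_v = s}`
    have hdec : ∀ s : ℤˣ, ρ.real {σ | σ (vert n) = s} = ρ.real ({σ | σ (vert n) = s} ∩ Aᶜ) +
        ∑ k ∈ Finset.Icc 1 K, ρ.real (outermostMinusCols n K k ∩ {σ | σ (vert n) = s}) := by
      intro s
      have h1 : ρ.real {σ | σ (vert n) = s} = ρ.real ({σ | σ (vert n) = s} ∩ A) + ρ.real ({σ | σ (vert n) = s} ∩ Aᶜ) := by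
        rw [← measureReal_inter_add_sdiff₀ hAm.nullMeasurableSet (s := {σ | σ (vert n) = s})]
        rfl
      have h2 : {σ : SpinConfig (Site 2) | σ (vert n) = s} ∩ A =
          ⋃ k ∈ Finset.Icc 1 K, (outermostMinusCols n K k ∩ {σ | σ (vert n) = s}) := by
        rw [hcover, Set.inter_iUnion₂]
        exact Set.iUnion₂_congr fun k _ => Set.inter_comm _ _
      rw [h1, h2, measureReal_biUnion_finset (hdisj.mono fun k => Set.inter_subset_left)
        (fun k _ => (measurableSet_outermostMinusCols n K k).inter (hm s))]
      ring
    rw [integral_spinAt_eq_measureReal_sub, hdec 1, hdec (-1)]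
    have hterm : ∀ k ∈ Finset.Icc 1 K, ρ.real (outermostMinusCols n K k ∩ {σ | σ (vert n) = 1}) ≤
        ρ.real (outermostMinusCols n K k ∩ {σ | σ (vert n) = -1}) := fun k hk => by
      simp only [measureReal_def]
      exact ENNReal.toReal_mono (measure_ne_top _ _)
        (stripMeasure_outermost_inter_plus_le hβ (Finset.mem_Icc.1 hk).1 (Finset.mem_Icc.1 hk).2)
    have hsum := Finset.sum_le_sum hterm
    have hAc : ρ.real ({σ | σ (vert n) = 1} ∩ Aᶜ) ≤ (1 - colDelta β n) ^ K := by
      have hsub : {σ : SpinConfig (Site 2) | σ (vert n) = 1} ∩ Aᶜ ⊆ ⋂ k ∈ Finset.Icc 1 K, (minusCols n k)ᶜ := by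
        intro σ hσ
        have := hσ.2
        rw [hA, Set.compl_iUnion₂] at this
        exact this
      exact (measureReal_mono hsub).trans (stripMeasure_noMinusCols_le β n K K le_rfl)
    have hnn : 0 ≤ ρ.real ({σ | σ (vert n) = -1} ∩ Aᶜ) := measureReal_nonneg
    linarith
  have hlt : 1 - colDelta β n < 1 := by linarith [colDelta_pos β n]
  have h0 : 0 ≤ 1 - colDelta β n := by linarith [colDelta_le_one β n]
  exact ge_of_tendsto (tendsto_pow_atTop_nhds_zero_of_lt_one h0 hlt) (Eventually.of_forall hbound)

end Strip

end Literature.Probability.LatticeModels
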